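import Literature.NumberTheory.FaltingsSerre.ParamodularTemplate
import HarnessLib

/-!
# The Faltings–Serre method after Brumer–Pacetti–Poor–Tornaría–Voight–Yuen, VIII:
# the instance `N = 461` (certificate `certs/461/certificate.canonical.json`, sha256 `8ab3284b29ac0abe…`)

[BPPTVY] = A. Brumer, A. Pacetti, C. Poor, G. Tornaría, J. Voight, D. S. Yuen, *On the paramodularity of
typical abelian surfaces*, Algebra & Number Theory **13**:5 (2019) 1145–1195 [cite: BrumerEtAl2019].
[PY15] = C. Poor, D. S. Yuen, *Paramodular cusp forms*, Math. Comp. **84** (2015) 1401–1438, Table 5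
(the level-461 eigenvalue line)  [cite: PoorYuen2015].  [PSY] = C. Poor, J. Shurman, D. S. Yuen,
*Nonlift weight two paramodular eigenform constructions*, J. Korean Math. Soc. 57 (2020) (the formula
`f₄₆₁ = Q/L` in Gritsenko lifts of theta blocks, file `QL-461.txt` of the authors' website).

This file is the `N = 461` INSTANCE of the template `paramodular_of_surfaceCertificate`
(`ParamodularTemplate.lean`): the abelian surface `A = Jac(C₄₆₁)`, `C₄₆₁ : y² + x³y = x⁵ − 3x³ + 3x − 2`
(LMFDB `461.a.461.1`, minimal equation `[[-2,3,0,-3,0,1],[0,0,0,1]]`), is paramodular of level `461` away from `461`, GIVEN (i) the cited Faltings–Serre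
criterion `hFS` ([BPPTVY, Thm 2.1.5], a hypothesis — see `CriterionProofs.lean` for its discharge
`traceEq_of_faltingsSerre_symplectic_holds`), (ii) the Arthur-dependent input `hρf` ([BPPTVY, Thm 4.3.4]),
and (iii) the CERTIFICATE `Certificate461` = `SurfaceCertificate 461 checkPrimes461`, a hypothesis
discharged outside the kernel by the cell's merged certificate `certs/461/certificate.canonical.json`
(sha256 `8ab3284b29ac0abe4aa6ce757e360b9c92c6673cf94300f080720087b6dbe5e3`), every datum by two independent implementations
(the last datum, `a₆₇(f₄₆₁) = 5`, by implementation A — two independent runs of the `T(67)` coset sum at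
truncation exponent `e = 4` — and by engine C, and it equals `a₆₇(A₄₆₁) = 5`).
No new mathematics is proved here; paramodularity of `A₄₆₁` is NOT a published theorem ([PY15]/[PSY]
construct `f₄₆₁` and list its eigenvalues; [BPPTVY] treats `N = 277, 353, 587` only), which is why the certificate is a
binder and this file asserts only the implication.
-/

noncomputable section

namespace Literature.NumberTheory.FaltingsSerre.Paramodular461

open Polynomial IsDedekindDomain
open Literature.NumberTheory.FaltingsSerre Literature.NumberTheory.GaloisRepresentations
  Literature.NumberTheory.Automorphic.Paramodular Literature.NumberTheory.Automorphic
  Literature.AlgebraicGeometry.Motives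
open scoped NumberField

/-- The check primes `P(461)` of the lead certificate (finest-invariant obstruction search on the
class-field data of `K₀` (degree 10), `4095` quadratic extensions; two independent search
implementations agree): `{3,5,7,11,13,17,19,23,29,31,67}`. [cite: BrumerEtAl2019, Alg 2.4.1 p. 1156 (the algorithm producing such a set)] -/
def checkPrimes461 : Finset ℕ := {3, 5, 7, 11, 13, 17, 19, 23, 29, 31, 67}

/-- Data check (private helper): eleven check primes, `67` the largest, `37 … 61` absent. [folklore] -/
private theorem checkPrimes461_card : checkPrimes461.card = 11 ∧ 67 ∈ checkPrimes461 ∧ 37 ∉ checkPrimes461 ∧ 47 ∉ checkPrimes461 := by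
  simp [checkPrimes461]

/-- **The `N = 461` certificate, as a hypothesis**: `SurfaceCertificate 461 checkPrimes461 J ν ρA ρf`
(`ParamodularTemplate.lean`; fields `similitude₁₂`, `det_isUnit`, `transpose_eq`, `diag_eq`,
`unramified₁₂`, `absIrreducible`, `residual_eq`, `complete`, `traces` of `Certificate`).  Discharged
OUTSIDE THE KERNEL by `certs/461/certificate.canonical.json` (sha256 `8ab3284b29ac0abe4aa6ce757e360b9c92c6673cf94300f080720087b6dbe5e3`) — blocks:
`residual` (image `S₅(b)`: `ℚ(A[2])` has quintic resolvent `x⁵+2x⁴−4x³−4x²+8x−4` (LMFDB `5.1.7376.1`), Galois group `S₅`;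
`ρ̄_f ≃ ρ̄_A` by Route T: transvection + an order-5 Frobenius, `Q₅(f₄₆₁) ≡ Φ₅ (mod 2)` ×2, candidate
fields from the LMFDB / Bordeaux tables — completeness CITED), `classfield`/`group_theory`/`obstructing` (`K₀` degree 10,
`4095` extensions, check primes = `checkPrimes461`), `trace_check` (`a_p(A₄₆₁) = a_p(f₄₆₁)` on
`checkPrimes461`, each side by two implementations). [cite: BrumerEtAl2019, Alg 2.4.1 p. 1156; Thm 2.1.5 p. 1150] -/
def Certificate461 (J : Matrix (Fin 4) (Fin 4) ℤ_[2]) (ν : Field.absoluteGaloisGroup ℚ → ℤ_[2])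
    (ρA ρf : FramedGaloisRep ℚ ℤ_[2] 4) : Prop :=
  SurfaceCertificate 461 checkPrimes461 J ν ρA ρf

/-- **`A₄₆₁` is paramodular of level `461` away from `461`, from the certificate.**  Binders exactly as
in `paramodular_of_surfaceCertificate` with `N = 461`, `T = checkPrimes461`; `h2` is the hand check
`L_2(A,T) = Q_2(f,T)` (`L_2 = 1 + 2T² + 4T⁴` both sides). [cite: BrumerEtAl2019, Thm 2.1.5 p. 1150; Thm 4.3.4 p. 1169; Alg 2.4.1 p. 1156] -/
theorem paramodular_461 (hFS : traceEq_of_faltingsSerre_symplectic)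
    {A : AbelianVariety ℚ} {f : Matrix (Fin 2) (Fin 2) ℂ → ℂ}
    {ρA ρf : FramedGaloisRep ℚ ℤ_[2] 4} {J : Matrix (Fin 4) (Fin 4) ℤ_[2]}
    {ν : Field.absoluteGaloisGroup ℚ → ℤ_[2]}
    {b : Module.Basis (Fin 4) ℚ_[2] (A.rationalTateModule 2)}
    (hC : Certificate461 J ν ρA ρf)
    (hframe : A.IsFrameOfTateRep 2 b (rationalize ρA))
    (aA bA af bf : ℕ → ℤ)
    (hA : ∀ p : ℕ, p.Prime → ¬ p ∣ 461 →
      A.HasGoodEulerFactorAt p ((lPolynomialOfSurface p (aA p) (bA p)).map (Int.castRingHom ℚ)))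
    (hρf : ∀ p : ℕ, p.Prime → ¬ p ∣ 461 → p ≠ 2 →
      ∀ v : HeightOneSpectrum (𝓞 ℚ), ((p : ℕ) : 𝓞 ℚ) ∈ v.asIdeal →
        ρf.HasFrobCharpolyAt v
          ((lPolynomialOfSurface p (af p) (bf p)).reverse.map (Int.castRingHom ℤ_[2])))
    (hcusp : IsParamodularCuspForm 461 2 f) (hne : ∃ Z ∈ siegelUpperHalfSpace 2, f Z ≠ 0)
    (hfe : ∀ p : ℕ, p.Prime → ¬ p ∣ 461 →
      HasSpinorEulerFactorAt 2 p f ((lPolynomialOfSurface p (af p) (bf p)).map (Int.castRingHom ℂ)))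
    (h2 : aA 2 = af 2 ∧ bA 2 = bf 2) :
    IsParamodularAwayFrom A 461 f :=
  paramodular_of_surfaceCertificate hFS hC hframe aA bA af bf hA hρf hcusp hne hfe (fun _ => h2)

/-- The conclusion at one prime `p ≠ 461`: one polynomial is both `L_p(A₄₆₁,T)` and `Q_p(f₄₆₁,T)`. [cite: BrumerEtAl2019, Thm 7.1.3 p. 1187 (shape of the statement)] -/
theorem eulerFactors_agree_461 {A : AbelianVariety ℚ} {f : Matrix (Fin 2) (Fin 2) ℂ → ℂ}
    (h : IsParamodularAwayFrom A 461 f) {p : ℕ} (hp : p.Prime) (hpN : p ≠ 461) :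
    ∃ Q : Polynomial ℚ, HasSpinorEulerFactorAt 2 p f (Q.map (algebraMap ℚ ℂ)) ∧
      A.HasGoodEulerFactorAt p Q :=
  eulerFactors_agree_of_prime (by norm_num) h hp hpN

end Literature.NumberTheory.FaltingsSerre.Paramodular461

end
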